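import Summits.KontsevichZagierPeriods.KontsevichZagierPeriods.Theorems.RootDecompQuadraticDescentZetaTwoPairsP3

/-!
# The ZETA2 stratum (15 census pairs among R1..R6 ∈ π²ℚ) DECIDED in `KZ.relations` (route `RootDecompQuadraticDescent`, instances of crux stmt-KontsevichZagierPeriods-28994 / stmt-4280) · part 4/5

Cell `decomp-kz`, lens 6 (decomp-kz-lens-6 g8b): ENGINE v3.1 — the bounded «triangle calculus» on sub-graph representations `SB(c;L,U)` (`sb_cut/affine/swap/unfold/add′`, `rel_opn/scale/shift/powB` ⟹ `sb_pow`; `rel_scale` over the OPEN base via `KZ.of_sub_of_mem_relations_of_affine`) decides every pair #23 #34 #35 #38–#49 of the cell census as an INTEGER relation (normal forms R1≡2A, R2≡4A−4W, R3≡2A−T, R4≡4W−2T, R5≡2W+2T, R6≡3W, 2T≡A, 3W≡2A); packaged `zetaTwoStratum_descentTwoQ_instances` and `zetaTwoPair_of_kzDimTwo` BY NAME.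

Source: `HOME/decomp-kz-lens-6/g8/ZetaTwoPairs.lean` sha256 a8aac2aea5cc880c (1299 l; critic decomp-kz-crit-1 g2 CLEARED 2026-08-30T09:03:21Z, std axioms), split into 5 modules by the landing seat decomp-kz-census-1 g7 (contexts re-opened per part; generic docstrings added where the source had none; the route file is imported only by the last part, which proves the `KZDimTwo` corollaries BY NAME).  No `sorry`; standard axioms.  References: [cite: KontsevichZagier2001, §1.2].
-/

noncomputable section

open MeasureTheory Set MvPolynomial

namespace Summit.KontsevichZagierPeriods.RootDecompQuadraticDescent.ZetaTwoPairs

open Literature.NumberTheory.Transcendental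
open Literature.NumberTheory.Transcendental.KZ
open Literature.ModelTheory.ExponentialFields (IsSemialgebraic)

-- PRIVATE copy (twin landed in …LogFibreP3 quad3_pos; dedup.landed): D1_pos
/-- `D1_pos`: auxiliary theorem of the lens-6 development «zeta2» (instances of 28994/4280) — see the module docstring; verbatim from the lens file. -/
private theorem D1_pos (t : ℝ) : 0 < 1 - t + t ^ 2 := by nlinarith [sq_nonneg (t - 1 / 2)]

-- PRIVATE copy (landed twin lives in a farm-unbuilt module; dedup.landed): snoc2_zero, snoc2_one, init2_zero
/-- `snoc2_zero`: auxiliary theorem of the lens-6 development «zeta2» (instances of 28994/4280) — see the module docstring; verbatim from the lens file. -/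
@[simp] private theorem snoc2_zero (x : Fin 1 → ℝ) (t : ℝ) : (Fin.snoc x t : Fin 2 → ℝ) 0 = x 0 := rfl

/-- `snoc2_one`: auxiliary theorem of the lens-6 development «zeta2» (instances of 28994/4280) — see the module docstring; verbatim from the lens file. -/
@[simp] private theorem snoc2_one (x : Fin 1 → ℝ) (t : ℝ) : (Fin.snoc x t : Fin 2 → ℝ) 1 = t := rfl

/-- `init2_zero`: auxiliary theorem of the lens-6 development «zeta2» (instances of 28994/4280) — see the module docstring; verbatim from the lens file. -/
@[simp] private theorem init2_zero (z : Fin 2 → ℝ) : Fin.init z 0 = z 0 := rfl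

/-- `X ≡ 2·Y`: `X ≡ X4 + SB(c; t+t³, 1+t)` (cut), `SB(c; t+t³, 1+t) ≡ Y` (affine map
`σ = t+t³ + (1+t²+t⁴)τ`, i.e. `B(1+t+t²) = B(1+t²+t⁴) + B(1/(1−t+t²))`), and `2·X4 ≡ X`
(power map `P₂` applied to `φ = 1 + u + u²`). -/
theorem x_rel (c : ℚ) : KZ.of (SB c zeroE opIdE) - 2 • KZ.of (SB c zeroE yE) ∈ KZ.relations := by
  have h1 := sb_cut c zeroE tCubE opIdE (fun t ht => by have := ht.1; simp; positivity)
    (fun t ht => by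
      simp only [tCubE_f, opIdE_f]
      nlinarith [pow_le_one₀ ht.1 ht.2 (n := 3)])
  have h2 := sb_affine c tCubE opIdE yE (by show Differentiable ℝ fun t : ℝ => t + t ^ 3; fun_prop)
    fun t _ => by
      have hD := (D1_pos t).ne'
      simp only [opIdE_f, tCubE_f, yE_f]
      field_simp
      ring
  have h3 := sb_pow 1 c (c / 2) (by ring) opIdE opSqE tCubE (fun t _ => by simp)
    (fun t _ => by simp; ring)
  have h4 := sb_half c zeroE opIdE
  have h := sub_mem (add_mem (sub_mem (KZ.relations.zsmul_mem h1 2) (KZ.relations.zsmul_mem h2 2))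
    (KZ.relations.zsmul_mem h3 2)) h4
  convert h using 1
  module

/-- `P ≡ 2·Q`: cut `P` along `σ = 1` and the affine map `σ = 1 + (1+t)τ`
(`B((1+t)²) = 2·B(1+t)`). -/
theorem p_rel (c : ℚ) : KZ.of (SB c zeroE twoPlusE) - 2 • KZ.of (SB c zeroE oneE) ∈ KZ.relations := by
  have h1 := sb_cut c zeroE oneE twoPlusE (fun t _ => by simp)
    (fun t ht => by simp only [oneE_f, twoPlusE_f]; linarith [ht.1])
  have h2 := sb_affine c oneE twoPlusE oneE (differentiable_const _) fun t _ => by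
    simp only [twoPlusE_f, oneE_f]; ring
  have h := sub_mem h1 h2
  convert h using 1
  abel

/-- `G ≡ 2·Q − Tl`: cut `P` along `σ = t` and the affine map `σ = t + (1+t²)τ`
(`B((1+t)²/(1+t²)) = B((1+t)²) − B(1+t²)`). -/
theorem g_rel (c : ℚ) :
    KZ.of (SB c zeroE gE) - 2 • KZ.of (SB c zeroE oneE) + KZ.of (SB c zeroE idE) ∈ KZ.relations := by
  have h1 := sb_cut c zeroE idE twoPlusE (fun t ht => by simpa using ht.1)
    (fun t ht => by simp only [idE_f, twoPlusE_f]; linarith [ht.1])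
  have h2 := sb_affine c idE twoPlusE gE (by exact differentiable_id) fun t _ => by
    have h : (1 : ℝ) + t ^ 2 ≠ 0 := by positivity
    simp only [twoPlusE_f, idE_f, gE_f]
    field_simp
    ring
  have h3 := p_rel c
  have h := add_mem (sub_mem h2 h1) h3
  convert h using 1
  abel

/-- `G2 ≡ 2·Q − X`: cut `P` along `σ = 1 + t` and the affine map `σ = 1 + t + (1+t+t²)τ`
(`B((1+t)²/(1+t+t²)) = B((1+t)²) − B(1+t+t²)`). -/
theorem g2_rel (c : ℚ) :
    KZ.of (SB c zeroE r2E) - 2 • KZ.of (SB c zeroE oneE) + KZ.of (SB c zeroE opIdE) ∈ KZ.relations := by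
  have h1 := sb_cut c zeroE opIdE twoPlusE (fun t ht => by simp only [zeroE_f, opIdE_f]; linarith [ht.1])
    (fun t _ => by simp only [opIdE_f, twoPlusE_f]; linarith)
  have h2 := sb_affine c opIdE twoPlusE r2E (by show Differentiable ℝ fun t : ℝ => 1 + t; fun_prop)
    fun t ht => by
      have h : (1 : ℝ) + t + t ^ 2 ≠ 0 := by have := ht.1; positivity
      simp only [twoPlusE_f, opIdE_f, r2E_f]
      field_simp
      ring
  have h3 := p_rel c
  have h := add_mem (sub_mem h2 h1) h3
  convert h using 1
  abel

/-- `G4 ≡ X − Tl`: cut `X` along `σ = t` and the affine map `σ = t + (1+t²)τ`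
(`B((1+t+t²)/(1+t²)) = B(1+t+t²) − B(1+t²)`). -/
theorem g4_rel (c : ℚ) :
    KZ.of (SB c zeroE r4E) - KZ.of (SB c zeroE opIdE) + KZ.of (SB c zeroE idE) ∈ KZ.relations := by
  have h1 := sb_cut c zeroE idE opIdE (fun t ht => by simpa using ht.1)
    (fun t _ => by simp only [idE_f, opIdE_f]; linarith)
  have h2 := sb_affine c idE opIdE r4E (by exact differentiable_id) fun t _ => by
    have h : (1 : ℝ) + t ^ 2 ≠ 0 := by positivity
    simp only [opIdE_f, idE_f, r4E_f]
    field_simp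
    ring
  have h := sub_mem h2 h1
  convert h using 1
  abel

/-- `differentiable_yE`: auxiliary theorem of the lens-6 development «zeta2» (instances of 28994/4280) — see the module docstring; verbatim from the lens file. -/
private theorem differentiable_yE : Differentiable ℝ yE.f := by
  show Differentiable ℝ fun t : ℝ => (1 - t) / (1 - t + t ^ 2)
  exact Differentiable.div (by fun_prop) (by fun_prop) fun t => (D1_pos t).ne'

/-- `G5 ≡ Y + Tl`: cut `G5` along `σ = (1−t)/(1−t+t²)` and the affine map with `1 + tM = 1/(1−t+t²)`
(`B((1+t²)/(1−t+t²)) = B(1/(1−t+t²)) + B(1+t²)`). -/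
theorem g5_rel (c : ℚ) :
    KZ.of (SB c zeroE r5E) - KZ.of (SB c zeroE yE) - KZ.of (SB c zeroE idE) ∈ KZ.relations := by
  have h1 := sb_cut c zeroE yE r5E (fun t ht => by simpa using yE.nonneg t ht)
    (fun t ht => by
      simp only [yE_f, r5E_f]
      exact div_le_div_of_nonneg_right (by linarith [ht.1]) (D1_pos t).le)
  have h2 := sb_affine c yE r5E idE differentiable_yE fun t _ => by
    have hD := (D1_pos t).ne'
    simp only [r5E_f, yE_f, idE_f]
    field_simp
    ring
  have h := sub_mem h1 h2
  convert h using 1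
  abel

/-- `G6 ≡ Y + X`: cut `G6` along `σ = (1−t)/(1−t+t²)` and the affine map with `1 + tM = 1/(1−t+t²)`
(`B((1+t+t²)/(1−t+t²)) = B(1/(1−t+t²)) + B(1+t+t²)`). -/
theorem g6_rel (c : ℚ) :
    KZ.of (SB c zeroE r6E) - KZ.of (SB c zeroE yE) - KZ.of (SB c zeroE opIdE) ∈ KZ.relations := by
  have h1 := sb_cut c zeroE yE r6E (fun t ht => by simpa using yE.nonneg t ht)
    (fun t ht => by
      simp only [yE_f, r6E_f]
      exact div_le_div_of_nonneg_right (by linarith [ht.1]) (D1_pos t).le)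
  have h2 := sb_affine c yE r6E opIdE differentiable_yE fun t _ => by
    have hD := (D1_pos t).ne'
    simp only [r6E_f, yE_f, opIdE_f]
    field_simp
    ring
  have h := sub_mem h1 h2
  convert h using 1
  abel

/-! ## §5 The six cube integrands `R1 … R6` of the ZETA2 stratum and their normal forms in the
half-weight atoms `A = SB(½;0,1)`, `T = SB(½;0,t)`, `W = SB(½;0,(1−t)/(1−t+t²))`
(values `π²/24`, `π²/48`, `π²/36`; relations `2T ≡ A`, `3W ≡ 2A`) -/

/-- `QR1`: auxiliary def of the lens-6 development «zeta2» (instances of 28994/4280) — see the module docstring; verbatim from the lens file. -/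
def QR1 : MvPolynomial (Fin 2) ℚ := 1 + X 0 * X 1
/-- `QR2`: auxiliary def of the lens-6 development «zeta2» (instances of 28994/4280) — see the module docstring; verbatim from the lens file. -/
def QR2 : MvPolynomial (Fin 2) ℚ := 1 + X 1 + X 0 * X 1 + X 1 ^ 2
/-- `QR3`: auxiliary def of the lens-6 development «zeta2» (instances of 28994/4280) — see the module docstring; verbatim from the lens file. -/
def QR3 : MvPolynomial (Fin 2) ℚ := 1 + 2 * X 0 * X 1 + X 1 ^ 2
/-- `QR4`: auxiliary def of the lens-6 development «zeta2» (instances of 28994/4280) — see the module docstring; verbatim from the lens file. -/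
def QR4 : MvPolynomial (Fin 2) ℚ := 1 + X 0 * X 1 + X 1 ^ 2
/-- `QR5`: auxiliary def of the lens-6 development «zeta2» (instances of 28994/4280) — see the module docstring; verbatim from the lens file. -/
def QR5 : MvPolynomial (Fin 2) ℚ := 1 - X 0 + X 0 ^ 2 + X 0 * X 1
/-- `QR6`: auxiliary def of the lens-6 development «zeta2» (instances of 28994/4280) — see the module docstring; verbatim from the lens file. -/
def QR6 : MvPolynomial (Fin 2) ℚ := 1 - X 0 + X 0 ^ 2 + 2 * X 0 * X 1

/-- `QR1_pos`: auxiliary theorem of the lens-6 development «zeta2» (instances of 28994/4280) — see the module docstring; verbatim from the lens file. -/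
private theorem QR1_pos {x : Fin 2 → ℝ} (hx : x ∈ cube 2) : 0 < aeval x QR1 := by
  have h0 := (hx 0).1; have h1 := (hx 1).1
  simp only [QR1, map_add, map_mul, map_one, aeval_X]
  nlinarith [mul_nonneg h0 h1]
/-- `QR2_pos`: auxiliary theorem of the lens-6 development «zeta2» (instances of 28994/4280) — see the module docstring; verbatim from the lens file. -/
private theorem QR2_pos {x : Fin 2 → ℝ} (hx : x ∈ cube 2) : 0 < aeval x QR2 := by
  have h0 := (hx 0).1; have h1 := (hx 1).1
  simp only [QR2, map_add, map_mul, map_pow, map_one, aeval_X]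
  nlinarith [mul_nonneg h0 h1, sq_nonneg (x 1)]
/-- `QR3_pos`: auxiliary theorem of the lens-6 development «zeta2» (instances of 28994/4280) — see the module docstring; verbatim from the lens file. -/
private theorem QR3_pos {x : Fin 2 → ℝ} (hx : x ∈ cube 2) : 0 < aeval x QR3 := by
  have h0 := (hx 0).1; have h1 := (hx 1).1
  simp only [QR3, map_add, map_mul, map_pow, map_ofNat, map_one, aeval_X]
  nlinarith [mul_nonneg h0 h1, sq_nonneg (x 1)]
/-- `QR4_pos`: auxiliary theorem of the lens-6 development «zeta2» (instances of 28994/4280) — see the module docstring; verbatim from the lens file. -/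
private theorem QR4_pos {x : Fin 2 → ℝ} (hx : x ∈ cube 2) : 0 < aeval x QR4 := by
  have h0 := (hx 0).1; have h1 := (hx 1).1
  simp only [QR4, map_add, map_mul, map_pow, map_one, aeval_X]
  nlinarith [mul_nonneg h0 h1, sq_nonneg (x 1)]
/-- `QR5_pos`: auxiliary theorem of the lens-6 development «zeta2» (instances of 28994/4280) — see the module docstring; verbatim from the lens file. -/
private theorem QR5_pos {x : Fin 2 → ℝ} (hx : x ∈ cube 2) : 0 < aeval x QR5 := by
  have h0 := (hx 0).1; have h1 := (hx 1).1
  simp only [QR5, map_add, map_sub, map_mul, map_pow, map_one, aeval_X]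
  nlinarith [mul_nonneg h0 h1, sq_nonneg (x 0 - 1 / 2)]
/-- `QR6_pos`: auxiliary theorem of the lens-6 development «zeta2» (instances of 28994/4280) — see the module docstring; verbatim from the lens file. -/
private theorem QR6_pos {x : Fin 2 → ℝ} (hx : x ∈ cube 2) : 0 < aeval x QR6 := by
  have h0 := (hx 0).1; have h1 := (hx 1).1
  simp only [QR6, map_add, map_sub, map_mul, map_pow, map_ofNat, map_one, aeval_X]
  nlinarith [mul_nonneg h0 h1, sq_nonneg (x 0 - 1 / 2)]

/-- `R1 = [□², 1/(1+xy)] = π²/12`, `R2 = [□², 1/(1+y+xy+y²)] = π²/18`,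
`R3 = [□², 1/(1+2xy+y²)] = π²/16`, `R4 = [□², 1/(1+xy+y²)] = 5π²/72`,
`R5 = [□², 1/(1−x+x²+xy)] = 7π²/72`, `R6 = [□², 1/(1−x+x²+2xy)] = π²/12` (census, ZETA2 stratum). -/
def R1 : RFun 2 := ⟨1, QR1, fun _ hx => (QR1_pos hx).ne'⟩
/-- `R2`: auxiliary def of the lens-6 development «zeta2» (instances of 28994/4280) — see the module docstring; verbatim from the lens file. -/
def R2 : RFun 2 := ⟨1, QR2, fun _ hx => (QR2_pos hx).ne'⟩
/-- `R3`: auxiliary def of the lens-6 development «zeta2» (instances of 28994/4280) — see the module docstring; verbatim from the lens file. -/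
def R3 : RFun 2 := ⟨1, QR3, fun _ hx => (QR3_pos hx).ne'⟩
/-- `R4`: auxiliary def of the lens-6 development «zeta2» (instances of 28994/4280) — see the module docstring; verbatim from the lens file. -/
def R4 : RFun 2 := ⟨1, QR4, fun _ hx => (QR4_pos hx).ne'⟩
/-- `R5`: auxiliary def of the lens-6 development «zeta2» (instances of 28994/4280) — see the module docstring; verbatim from the lens file. -/
def R5 : RFun 2 := ⟨1, QR5, fun _ hx => (QR5_pos hx).ne'⟩
/-- `R6`: auxiliary def of the lens-6 development «zeta2» (instances of 28994/4280) — see the module docstring; verbatim from the lens file. -/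
def R6 : RFun 2 := ⟨1, QR6, fun _ hx => (QR6_pos hx).ne'⟩

/-- Unfoldings: `R1 ≡ Q(1)`, `R2 ≡ G2(1)`, `R3 ≡ G(½)`, `R4 ≡ G4(1)`, `R5 ≡ G5(1)`, `R6 ≡ G6(½)`
(for `R2, R3, R4` after `x ↔ y`). -/
private theorem r1_unf : KZ.of R1.rep - KZ.of (SB 1 zeroE oneE) ∈ KZ.relations := by
  refine sb_cube R1 1 fun z _ => ?_
  simp only [RFun.fn, R1, QR1, map_add, map_mul, map_one, aeval_X, Rat.cast_one]

/-- `r2_unf`: auxiliary theorem of the lens-6 development «zeta2» (instances of 28994/4280) — see the module docstring; verbatim from the lens file. -/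
theorem r2_unf : KZ.of R2.rep - KZ.of (SB 1 zeroE r2E) ∈ KZ.relations := by
  have h1 := RFun.rel_rename R2 (Equiv.swap 0 1)
  have h2 : KZ.of (R2.rename (Equiv.swap 0 1)).rep - KZ.of (SB 1 zeroE r2E) ∈ KZ.relations := by
    refine sb_unfold _ 1 1 (by norm_num) (fun t => 1 + t + t ^ 2) (1 + X 0 + X 0 ^ 2) (fun z => by simp)
      (by fun_prop) (fun t ht => by have := ht.1; positivity) (fun z _ => ?_) r2E (fun t _ => by simp)
    rw [RFun.fn_rename]
    simp only [RFun.fn, R2, QR2, map_add, map_mul, map_pow, map_one, aeval_X,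
      Function.comp_apply, Equiv.swap_apply_left, Equiv.swap_apply_right]
    push_cast
    ring
  have h := add_mem h1 h2
  convert h using 1
  abel

/-- `r3_unf`: auxiliary theorem of the lens-6 development «zeta2» (instances of 28994/4280) — see the module docstring; verbatim from the lens file. -/
theorem r3_unf : KZ.of R3.rep - KZ.of (SB (1 / 2) zeroE gE) ∈ KZ.relations := by
  have h1 := RFun.rel_rename R3 (Equiv.swap 0 1)
  have h2 : KZ.of (R3.rename (Equiv.swap 0 1)).rep - KZ.of (SB (1 / 2) zeroE gE) ∈ KZ.relations := by
    refine sb_unfold _ (1 / 2) 2 (by norm_num) (fun t => 1 + t ^ 2) (1 + X 0 ^ 2) (fun z => by simp)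
      (by fun_prop) (fun t _ => by positivity) (fun z hz => ?_) gE (fun t _ => by simp)
    have hq : (1 : ℝ) + z 0 ^ 2 + 2 * z 0 * z 1 ≠ 0 := by
      have h0 := (hz 0).1; have h1' := (hz 1).1; nlinarith [mul_nonneg h0 h1', sq_nonneg (z 0)]
    rw [RFun.fn_rename]
    simp only [RFun.fn, R3, QR3, map_add, map_mul, map_pow, map_ofNat, map_one, aeval_X,
      Function.comp_apply, Equiv.swap_apply_left, Equiv.swap_apply_right]
    push_cast
    field_simp
    try ring
  have h := add_mem h1 h2
  convert h using 1
  abel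

/-- `r4_unf`: auxiliary theorem of the lens-6 development «zeta2» (instances of 28994/4280) — see the module docstring; verbatim from the lens file. -/
theorem r4_unf : KZ.of R4.rep - KZ.of (SB 1 zeroE r4E) ∈ KZ.relations := by
  have h1 := RFun.rel_rename R4 (Equiv.swap 0 1)
  have h2 : KZ.of (R4.rename (Equiv.swap 0 1)).rep - KZ.of (SB 1 zeroE r4E) ∈ KZ.relations := by
    refine sb_unfold _ 1 1 (by norm_num) (fun t => 1 + t ^ 2) (1 + X 0 ^ 2) (fun z => by simp)
      (by fun_prop) (fun t _ => by positivity) (fun z _ => ?_) r4E (fun t _ => by simp)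
    rw [RFun.fn_rename]
    simp only [RFun.fn, R4, QR4, map_add, map_mul, map_pow, map_one, aeval_X,
      Function.comp_apply, Equiv.swap_apply_left, Equiv.swap_apply_right]
    push_cast
    ring
  have h := add_mem h1 h2
  convert h using 1
  abel

/-- `r5_unf`: auxiliary theorem of the lens-6 development «zeta2» (instances of 28994/4280) — see the module docstring; verbatim from the lens file. -/
private theorem r5_unf : KZ.of R5.rep - KZ.of (SB 1 zeroE r5E) ∈ KZ.relations := by
  refine sb_unfold R5 1 1 (by norm_num) (fun t => 1 - t + t ^ 2) (1 - X 0 + X 0 ^ 2) (fun z => by simp)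
    (by fun_prop) (fun t _ => D1_pos t) (fun z _ => ?_) r5E (fun t _ => by simp)
  simp only [RFun.fn, R5, QR5, map_add, map_sub, map_mul, map_pow, map_one, aeval_X]
  push_cast
  ring

/-- `r6_unf`: auxiliary theorem of the lens-6 development «zeta2» (instances of 28994/4280) — see the module docstring; verbatim from the lens file. -/
theorem r6_unf : KZ.of R6.rep - KZ.of (SB (1 / 2) zeroE r6E) ∈ KZ.relations := by
  refine sb_unfold R6 (1 / 2) 2 (by norm_num) (fun t => 1 - t + t ^ 2) (1 - X 0 + X 0 ^ 2)
    (fun z => by simp) (by fun_prop) (fun t _ => D1_pos t) (fun z hz => ?_) r6E (fun t _ => by simp)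
  have hq : (1 : ℝ) - z 0 + z 0 ^ 2 + 2 * z 0 * z 1 ≠ 0 := by
    have h0 := (hz 0).1; have h1' := (hz 1).1
    nlinarith [mul_nonneg h0 h1', sq_nonneg (z 0 - 1 / 2)]
  simp only [RFun.fn, R6, QR6, map_add, map_sub, map_mul, map_pow, map_ofNat, map_one, aeval_X]
  push_cast
  field_simp
  try ring

/-- Normal forms in the atoms `A = SB(½;0,1)`, `T = SB(½;0,t)`, `W = SB(½;0,yE)`:
`R1 ≡ 2A`, `R2 ≡ 4A − 4W`, `R3 ≡ 2A − T`, `R4 ≡ 4W − 2T`, `R5 ≡ 2W + 2T`, `R6 ≡ 3W`. -/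
theorem r1_atoms : KZ.of R1.rep - 2 • KZ.of (SB (1 / 2) zeroE oneE) ∈ KZ.relations := by
  have h := add_mem r1_unf (sb_half 1 zeroE oneE)
  convert h using 1
  abel

/-- `r2_atoms`: auxiliary theorem of the lens-6 development «zeta2» (instances of 28994/4280) — see the module docstring; verbatim from the lens file. -/
theorem r2_atoms : KZ.of R2.rep - 4 • KZ.of (SB (1 / 2) zeroE oneE) + 4 • KZ.of (SB (1 / 2) zeroE yE) ∈
    KZ.relations := by
  have h := sub_mem (sub_mem (add_mem (add_mem r2_unf (g2_rel 1))
    (KZ.relations.zsmul_mem (sb_half 1 zeroE oneE) 2)) (sb_half 1 zeroE opIdE))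
    (KZ.relations.zsmul_mem (x_rel (1 / 2)) 2)
  convert h using 1
  module

/-- `r3_atoms`: auxiliary theorem of the lens-6 development «zeta2» (instances of 28994/4280) — see the module docstring; verbatim from the lens file. -/
theorem r3_atoms : KZ.of R3.rep - 2 • KZ.of (SB (1 / 2) zeroE oneE) + KZ.of (SB (1 / 2) zeroE idE) ∈
    KZ.relations := by
  have h := add_mem r3_unf (g_rel (1 / 2))
  convert h using 1
  abel

/-- `r4_atoms`: auxiliary theorem of the lens-6 development «zeta2» (instances of 28994/4280) — see the module docstring; verbatim from the lens file. -/
theorem r4_atoms : KZ.of R4.rep - 4 • KZ.of (SB (1 / 2) zeroE yE) + 2 • KZ.of (SB (1 / 2) zeroE idE) ∈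
    KZ.relations := by
  have h := sub_mem (add_mem (add_mem (add_mem r4_unf (g4_rel 1)) (sb_half 1 zeroE opIdE))
    (KZ.relations.zsmul_mem (x_rel (1 / 2)) 2)) (sb_half 1 zeroE idE)
  convert h using 1
  module

/-- `r5_atoms`: auxiliary theorem of the lens-6 development «zeta2» (instances of 28994/4280) — see the module docstring; verbatim from the lens file. -/
theorem r5_atoms : KZ.of R5.rep - 2 • KZ.of (SB (1 / 2) zeroE yE) - 2 • KZ.of (SB (1 / 2) zeroE idE) ∈
    KZ.relations := by
  have h := add_mem (add_mem (add_mem r5_unf (g5_rel 1)) (sb_half 1 zeroE yE)) (sb_half 1 zeroE idE)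
  convert h using 1
  abel

end Summit.KontsevichZagierPeriods.RootDecompQuadraticDescent.ZetaTwoPairs

end
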